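import Summits.BirchSwinnertonDyer.BirchSwinnertonDyer.Theorems.KatoDescentPotSupersingularZetaBodyScaling
import Mathlib.RingTheory.Flat.Basic
import HarnessLib

/-!
# A PINNED LEVEL ties the constant `κ` to the scale of Kato's classes: if two `ZetaBody` data with
# classes `z` and `n•z` share the value functional at ONE level carrying a non-vanishing twisted
# `L`-value, their constants satisfy `κ' = n·κ` (the positive complement of the rank-one decoupling;
# K9 `WildRankOne` 19200 / KT `TameRankOne` 19984, D-O6-2″)

Cell `bsd-potss` (FULL-BSD rank ≤ 1, tranche 1b), seat `bsd-potss-kmc`, generation 11, PART 18b; memo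
HOME/bsd-potss-kmc/KMC-DESCENT-MEMO-v10.md §2.  ROUTE-FREE; `--supports stmt-BirchSwinnertonDyer-19200`.

WHAT THIS SHOWS.  PART 17c (`zetaBody_smul`) and PART 18a (`zetaBody_rescale`, `zetaBody_smul_offBottom`,
`zetaBody_bottom_smul`) exhibit the symmetries of the tree's zeta data `Kato2004.ZetaBody`: the classes
can be scaled `z ↦ n•z` either together with the constant (`κ ↦ n·κ`, functionals fixed) or — when the
bottom value vanishes, i.e. in analytic rank one — with `κ` AND the bottom functional `Λ_{0,∅}` fixed
(the other functionals divided by `n`).  This file proves the converse bookkeeping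
(`kappa_eq_natCast_mul_of_eq_at_level`): if `(κ, Λ, z, x)` and `(κ', Λ', n•z, x')` both satisfy
`ZetaBody` and the two functional families AGREE at one level `(k, r)`, `Λ'_{k,r} = Λ_{k,r}`, at which
some EVEN character `χ` has `L_χ(1) · R⁻_χ ≠ 0` (a non-vanishing depleted twisted `L`-value times
Kato's four-cusp factor; `Ω⁺_f ≠ 0`), then `κ' = n·κ` — by (C4) `x'_{k,r} = n·x_{k,r}`
(`value_eq_natCast_mul_of_eq_at_level`; `y ↦ 1 ⊗ y` is injective, `ℚ(ζ_m)` being flat over `ℚ`) and by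
(C5) `n·κ·L·R = κ'·L·R`.  CONSEQUENCE (memo v10 §2, the corrected typer request of D-O6-2″): a clause
pinning the value functional at ANY ONE level with a non-vanishing value — e.g. the `χ_D`-part at a tame
level `r = prime(D)` of a RANK-ZERO quadratic twist `E^D`, where the dual exponential is pinned over
`ℚ_p` itself by its kernel (the local Kummer image of `E^D(ℚ_p)`) and its image lattice
`c_p(E^D)·p^{−τ}ℤ_p` (Kim–Nakamura) — forces every admissible rescaling of the classes to rescale `κ`
by the same factor, so that `pos(𝐲₀) − v_p(κ)` (with `κ ∈ ℚ`) becomes an invariant of the pinned data: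
the currency in which a Perrin-Riou node CAN be closed.  The bottom level `m = 1` never qualifies in
analytic rank one (its only value is `κ·L_{(pA)}(f,1)/Ω⁺·R⁻ = 0`, PART 18a).  Nothing about BSD is
asserted; no definition, no named fact.

References: K. Kato, Astérisque 295 (2004) Thm. 9.7, Thm. 6.6 (1), Thm. 12.5 (1) [Kato2004Asterisque];
D. Burns, M. Kurihara, T. Sano, arXiv:1910.07404, Hyp. 2.2 / Rem. 2.3 [BurnsKuriharaSano2019];
C.-H. Kim, AJM 148 (2026) §3.2.3 [Kim2022StructureSelmer]; tree `Kato2004/EulerSystemValues.lean`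
(`ZetaBody`), `Theorems/…ZetaBodyScaling` (PART 17c), `Theorems/…ZetaBodyRankOneDecoupling` (PART 18a).
-/

set_option autoImplicit false
set_option linter.dupNamespace false

noncomputable section

open scoped NumberField TensorProduct Pointwise
open Field IsDedekindDomain CongruenceSubgroup
open Literature.NumberTheory.GaloisRepresentations
open Literature.NumberTheory.EllipticCurves Literature.NumberTheory.EllipticCurves.ModularForms
open Literature.NumberTheory.EllipticCurves.Kato2004
open Literature.NumberTheory.EllipticCurves.Kato2004.EulerSystemValues Rat.HeightOneSpectrum

namespace Summit.BirchSwinnertonDyer.BirchSwinnertonDyer.Theorems.ZetaBodyScaling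

section Injective

variable {p : ℕ} [Fact p.Prime]

/-- `y ↦ 1 ⊗ y : K → ℚ_p ⊗_ℚ K` is injective for a field `K ⊇ ℚ` (`K` is flat over `ℚ`,
`ℚ → ℚ_p` injective; Mathlib `Algebra.TensorProduct.includeRight_injective`). [folklore] -/
theorem one_tmul_injective (K : Type*) [Field K] [Algebra ℚ K] :
    Function.Injective (fun y : K ↦ (1 : ℚ_[p]) ⊗ₜ[ℚ] y) :=
  Algebra.TensorProduct.includeRight_injective (R := ℚ) (A := ℚ_[p]) (B := K)
    (algebraMap ℚ ℚ_[p]).injective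

end Injective

section PinnedLevel

variable {W : WeierstrassCurve ℚ} [W.IsElliptic] {p : ℕ} [Fact p.Prime]
  [ContinuousSMul ℤ_[p] (W.tateModule p)] [Module.Free ℤ_[p] (W.tateModule p)]
  [Module.Finite ℤ_[p] (W.tateModule p)] {N : ℕ} {f : CuspForm (Gamma0 N) 2}
  {ι : (m : ℕ) → (CyclotomicField m ℚ →+* ℂ)} {κ κ' : ℝ}
  {Λ Λ' : ∀ (k : ℕ) (r : Finset (HeightOneSpectrum (𝓞 ℚ))),
    H1 (tateRep W p) (cycSubgroup p k r) →ₗ[ℤ_[p]] ℚ_[p] ⊗[ℚ] CyclotomicField (cycLevel p k r) ℚ}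
  {c d a : ℤ} {A : ℕ}
  {z : ∀ (k : ℕ) (r : (cyclotomicLevelsRat p (badPlaces c d A N)).Ideals),
    H1 (tateRep W p) ((cyclotomicLevelsRat p (badPlaces c d A N)).level k r.1)}
  {x x' : ∀ (k : ℕ) (r : (cyclotomicLevelsRat p (badPlaces c d A N)).Ideals),
    CyclotomicField (cycLevel p k r.1) ℚ}

/-- **At a level where the functionals agree, the values of `n•z` are `n` times the values of `z`.**
If `(κ, Λ, z, x)` and `(κ', Λ', n•z, x')` satisfy `ZetaBody` and `Λ'_{k,r} = Λ_{k,r}`, then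
`x'_{k,r} = n·x_{k,r}` ((C4) for both data: `1 ⊗ x' = Λ'(n•z) = n•Λ(z) = 1 ⊗ n·x`, and `y ↦ 1 ⊗ y` is
injective). [cite: Kato2004Asterisque, Thm. 9.7 (p. 189)] -/
theorem value_eq_natCast_mul_of_eq_at_level (n : ℕ) (h : ZetaBody W p f ι κ Λ c d a A z x)
    (h' : ZetaBody W p f ι κ' Λ' c d a A ((n : ℤ_[p]) • z) x')
    {k : ℕ} {r : (cyclotomicLevelsRat p (badPlaces c d A N)).Ideals} (hΛ : Λ' k r.1 = Λ k r.1) :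
    x' k r = (n : CyclotomicField (cycLevel p k r.1) ℚ) * x k r := by
  have hn := zetaBody_smul n h
  obtain ⟨-, -, -, -, h4', -⟩ := h'
  obtain ⟨-, -, -, -, h4n, -⟩ := hn
  apply one_tmul_injective (p := p)
  dsimp only
  rw [← h4' k r, hΛ]
  exact h4n k r

/-- **A PINNED LEVEL WITH A NON-VANISHING VALUE TIES `κ` TO THE SCALE OF THE CLASSES.**  Let
`(κ, Λ, z, x)` and `(κ', Λ', n•z, x')` satisfy `ZetaBody W p f ι …` for the same `(f, ι, c, d, a, A)`,
and suppose the functional families agree at the level `(k, r)`: `Λ'_{k,r} = Λ_{k,r}`.  If at that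
level some EVEN Dirichlet character `χ` (guards `(cd, mA) = 1`, `dd′ ≡ 1 (A)`) has an entire depleted
continuation `L_χ` with `L_χ(1) ≠ 0`, four-cusp factor `R⁻_χ ≠ 0`, and `Ω⁺_f ≠ 0`, then **`κ' = n·κ`**:
by `value_eq_natCast_mul_of_eq_at_level` and `charSum_natCast_mul`, (C5) for the two data reads
`n·κ·L_χ(1)/Ω⁺·R⁻_χ = κ'·L_χ(1)/Ω⁺·R⁻_χ`.  So over data PINNED at such a level the only admissible
rescaling of the classes is `(κ, z) ↦ (n·κ, n•z)` and `pos(𝐲₀) − v_p(κ)` is invariant — in contrast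
with the bottom level in analytic rank one (PART 18a `zetaBody_smul_offBottom`: value `0`, `κ` fixed).
[cite: Kato2004Asterisque, Thm. 9.7 (p. 189), Thm. 6.6 (1) (p. 163)]
[cite: BurnsKuriharaSano2019, Hyp. 2.2 and Remark 2.3 (p. 9)] -/
theorem kappa_eq_natCast_mul_of_eq_at_level (n : ℕ) (h : ZetaBody W p f ι κ Λ c d a A z x)
    (h' : ZetaBody W p f ι κ' Λ' c d a A ((n : ℤ_[p]) • z) x')
    {k : ℕ} {r : (cyclotomicLevelsRat p (badPlaces c d A N)).Ideals} (hΛ : Λ' k r.1 = Λ k r.1)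
    (d' : ℤ) (χ : DirichletCharacter ℂ (cycLevel p k r.1)) (Lχ : ℂ → ℂ)
    (hcd : Int.gcd (c * d) (cycLevel p k r.1 * A) = 1) (hdd' : d * d' ≡ 1 [ZMOD (A : ℤ)])
    (hL : IsDepletedTwistedL f (cycLevel p k r.1) (p * A) χ Lχ) (hχ : χ (-1) = 1)
    (hL1 : Lχ 1 ≠ 0) (hR : cuspFactor f true (fun m ↦ χ⁻¹ (m : ZMod (cycLevel p k r.1))) c d a A d' ≠ 0)
    (hΩ : plusPeriod f ≠ 0) :
    κ' = (n : ℝ) * κ := by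
  have hx := value_eq_natCast_mul_of_eq_at_level n h h' hΛ
  obtain ⟨-, -, -, -, -, h5⟩ := h
  obtain ⟨-, -, -, -, -, h5'⟩ := h'
  have hv := (h5 k r d' χ Lχ hcd hdd' hL).1 hχ
  have hv' := (h5' k r d' χ Lχ hcd hdd' hL).1 hχ
  rw [hx, charSum_natCast_mul, hv] at hv'
  -- hv' : n * (κ * (L/Ω) * R) = κ' * (L/Ω) * R
  have hΩC : (plusPeriod f : ℂ) ≠ 0 := by exact_mod_cast hΩ
  have hq : Lχ 1 / (plusPeriod f : ℂ) ≠ 0 := div_ne_zero hL1 hΩC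
  have hprod : (Lχ 1 / (plusPeriod f : ℂ)) *
      cuspFactor f true (fun m ↦ χ⁻¹ (m : ZMod (cycLevel p k r.1))) c d a A d' ≠ 0 :=
    mul_ne_zero hq hR
  have hC : ((n : ℂ) * (κ : ℂ) - (κ' : ℂ)) *
      ((Lχ 1 / (plusPeriod f : ℂ)) *
        cuspFactor f true (fun m ↦ χ⁻¹ (m : ZMod (cycLevel p k r.1))) c d a A d') = 0 := by
    linear_combination hv'
  have hC' : (n : ℂ) * (κ : ℂ) - (κ' : ℂ) = 0 :=
    (mul_eq_zero.mp hC).resolve_right hprod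
  have hreal : ((((n : ℝ) * κ - κ' : ℝ)) : ℂ) = 0 := by
    push_cast
    exact hC'
  have := Complex.ofReal_eq_zero.mp hreal
  linarith

/-- The same with an ODD character (`χ(−1) = −1`; value `−κ·L_χ(1)/(iΩ⁻_f)·R⁺_χ`, `Ω⁻_f ≠ 0`).
[cite: Kato2004Asterisque, Thm. 9.7 (p. 189), Thm. 6.6 (1) (p. 163)] -/
theorem kappa_eq_natCast_mul_of_eq_at_level_odd (n : ℕ) (h : ZetaBody W p f ι κ Λ c d a A z x)
    (h' : ZetaBody W p f ι κ' Λ' c d a A ((n : ℤ_[p]) • z) x')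
    {k : ℕ} {r : (cyclotomicLevelsRat p (badPlaces c d A N)).Ideals} (hΛ : Λ' k r.1 = Λ k r.1)
    (d' : ℤ) (χ : DirichletCharacter ℂ (cycLevel p k r.1)) (Lχ : ℂ → ℂ)
    (hcd : Int.gcd (c * d) (cycLevel p k r.1 * A) = 1) (hdd' : d * d' ≡ 1 [ZMOD (A : ℤ)])
    (hL : IsDepletedTwistedL f (cycLevel p k r.1) (p * A) χ Lχ) (hχ : χ (-1) = -1)
    (hL1 : Lχ 1 ≠ 0)
    (hR : cuspFactor f false (fun m ↦ χ⁻¹ (m : ZMod (cycLevel p k r.1))) c d a A d' ≠ 0)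
    (hΩ : minusPeriod f ≠ 0) :
    κ' = (n : ℝ) * κ := by
  have hx := value_eq_natCast_mul_of_eq_at_level n h h' hΛ
  obtain ⟨-, -, -, -, -, h5⟩ := h
  obtain ⟨-, -, -, -, -, h5'⟩ := h'
  have hv := (h5 k r d' χ Lχ hcd hdd' hL).2 hχ
  have hv' := (h5' k r d' χ Lχ hcd hdd' hL).2 hχ
  rw [hx, charSum_natCast_mul, hv] at hv'
  have hΩC : Complex.I * (minusPeriod f : ℂ) ≠ 0 :=
    mul_ne_zero Complex.I_ne_zero (by exact_mod_cast hΩ)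
  have hq : Lχ 1 / (Complex.I * (minusPeriod f : ℂ)) ≠ 0 := div_ne_zero hL1 hΩC
  have hprod : (Lχ 1 / (Complex.I * (minusPeriod f : ℂ))) *
      cuspFactor f false (fun m ↦ χ⁻¹ (m : ZMod (cycLevel p k r.1))) c d a A d' ≠ 0 :=
    mul_ne_zero hq hR
  have hC : ((n : ℂ) * (κ : ℂ) - (κ' : ℂ)) *
      ((Lχ 1 / (Complex.I * (minusPeriod f : ℂ))) *
        cuspFactor f false (fun m ↦ χ⁻¹ (m : ZMod (cycLevel p k r.1))) c d a A d') = 0 := by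
    linear_combination -hv'
  have hC' : (n : ℂ) * (κ : ℂ) - (κ' : ℂ) = 0 :=
    (mul_eq_zero.mp hC).resolve_right hprod
  have hreal : ((((n : ℝ) * κ - κ' : ℝ)) : ℂ) = 0 := by
    push_cast
    exact hC'
  have := Complex.ofReal_eq_zero.mp hreal
  linarith

/-- **Corollary (same constant ⟹ no rescaling).**  If the two data have the SAME constant `κ ≠ 0` and
agree at a level with a non-vanishing even value, then `n = 1`: the classes of the second datum are
the classes of the first.  (With PART 18a: in analytic rank one this can only come from a level
`m > 1`.) [cite: Kato2004Asterisque, Thm. 9.7 (p. 189), Thm. 6.6 (1) (p. 163)] -/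
theorem eq_one_of_eq_at_level_of_kappa_eq (n : ℕ) (hκ : κ ≠ 0)
    (h : ZetaBody W p f ι κ Λ c d a A z x)
    (h' : ZetaBody W p f ι κ Λ' c d a A ((n : ℤ_[p]) • z) x')
    {k : ℕ} {r : (cyclotomicLevelsRat p (badPlaces c d A N)).Ideals} (hΛ : Λ' k r.1 = Λ k r.1)
    (d' : ℤ) (χ : DirichletCharacter ℂ (cycLevel p k r.1)) (Lχ : ℂ → ℂ)
    (hcd : Int.gcd (c * d) (cycLevel p k r.1 * A) = 1) (hdd' : d * d' ≡ 1 [ZMOD (A : ℤ)])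
    (hL : IsDepletedTwistedL f (cycLevel p k r.1) (p * A) χ Lχ) (hχ : χ (-1) = 1)
    (hL1 : Lχ 1 ≠ 0) (hR : cuspFactor f true (fun m ↦ χ⁻¹ (m : ZMod (cycLevel p k r.1))) c d a A d' ≠ 0)
    (hΩ : plusPeriod f ≠ 0) :
    n = 1 := by
  have hk := kappa_eq_natCast_mul_of_eq_at_level n h h' hΛ d' χ Lχ hcd hdd' hL hχ hL1 hR hΩ
  have h1 : ((n : ℝ) - 1) * κ = 0 := by linear_combination -hk
  have h2 : (n : ℝ) - 1 = 0 := (mul_eq_zero.mp h1).resolve_right hκ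
  exact_mod_cast (sub_eq_zero.mp h2)

end PinnedLevel

end Summit.BirchSwinnertonDyer.BirchSwinnertonDyer.Theorems.ZetaBodyScaling

end
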